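import Summits.Ventures.HodgeRepro2.T5SU11LegendreVieta
import Summits.Ventures.HodgeRepro2.T5SU11LegendreDerivCoeff
import Summits.Ventures.HodgeRepro2.T5SU11DiscreteLegendreTransform
import Summits.Ventures.HodgeRepro2.T5SU11LegendreLebesgue

/-!
# The Legendre chapter, summary V: Vieta for the zeros, the Legendre series of smooth functions (absolute
summability, uniform convergence, the rate `O(d⁻³)`, termwise differentiation, the coefficients of the
derivative), Lebesgue's inequality, the discrete transform, and the Gauss–Legendre error for smooth functions

One entry point, under uniform names, for rows 421–429 (files `T5SU11LegendreVieta`, `…CoefficientDecay`,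
`…SeriesUniform`, `…GaussLegendreTaylorError`, `…SeriesRate`, `…SeriesDeriv`, `…DerivCoeff`,
`…DiscreteLegendreTransform`, `…LegendreLebesgue`), plus one new corollary combining rows 424 and 425:

  **`|∫_{−1}^{1} f − Q_n f| ≤ 4 √(∫ (L²f)²) / (2n − 1)³`** for every `C⁴` function `f` and `n ≥ 1`
  (`gauss_error_C4`): the `n`-point Gauss–Legendre error of a `C⁴` function is `O(n⁻³)`.

Nothing is claimed about (N).

Blind lane: Mathlib + the HodgeRepro2 prefix only; no sorry; axioms ⊆ {propext, Classical.choice,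
Quot.sound}.
-/

namespace Summit.Ventures.HodgeRepro2.T5SU11LegendreSummaryV

open Polynomial intervalIntegral Finset Filter Topology MeasureTheory
open Set (Icc Ioo EqOn)
open T5SU11SphericalLegendreAll T5SU11JacobiPhaseLawEven T5SU11JacobiLegendreLeading T5SU11LegendreIdentities
  T5SU11LegendreOrthogonal T5SU11LegendreOrthogonalLower T5SU11LegendreExpansion T5SU11LegendreSeries
  T5SU11GaussLegendre T5SU11GaussLegendreConvergence T5SU11LegendreVieta T5SU11LegendreCoefficientDecay
  T5SU11LegendreSeriesUniform T5SU11GaussLegendreTaylorError T5SU11LegendreSeriesRate T5SU11LegendreSeriesDeriv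
  T5SU11LegendreDerivCoeff T5SU11DiscreteLegendreTransform T5SU11LegendreLebesgue T5SU11LegendreHeine

/-! ### Vieta (row 421) -/

/-- `Σ_i x_i = 0` over the zeros of `P_n` (`n ≥ 1`). -/
theorem vieta_sum {n : ℕ} (hn : 1 ≤ n) : ∑ x ∈ nodes n, x = 0 := sum_nodes hn

/-- `Σ_{i<j} x_i x_j = −n(n − 1)/(2(2n − 1))` (`n ≥ 2`). -/
theorem vieta_esymm_two {n : ℕ} (hn : 2 ≤ n) :
    ∑ t ∈ (nodes n).powersetCard 2, ∏ x ∈ t, x = -((n : ℝ) * ((n : ℝ) - 1) / (2 * (2 * (n : ℝ) - 1))) :=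
  esymm_two_nodes hn

/-- `Σ_i x_i² = n(n − 1)/(2n − 1)` (`n ≥ 1`). -/
theorem vieta_sum_sq {n : ℕ} (hn : 1 ≤ n) : ∑ x ∈ nodes n, x ^ 2 = (n : ℝ) * ((n : ℝ) - 1) / (2 * (n : ℝ) - 1) :=
  sum_sq_nodes hn

/-- `∏_i x_i = (−1)^n P_n(0)/lc_n`; `= (−1)^m C(2m, m) 4^{−m}/lc_{2m}` for `n = 2m`. -/
theorem vieta_prod (n : ℕ) : ∏ x ∈ nodes n, x = (-1) ^ n * legP n 0 / legLead n := prod_nodes n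

/-- The mean square of the zeros tends to `1/2`. -/
theorem vieta_mean_sq_tendsto : Tendsto (fun n : ℕ => (∑ x ∈ nodes n, x ^ 2) / n) atTop (𝓝 (1 / 2)) :=
  tendsto_mean_sq_nodes

/-! ### The Legendre series of smooth functions (rows 422–427) -/

section C2

variable {f f' f'' : ℝ → ℝ}
  (hf : ∀ x ∈ Icc (-1 : ℝ) 1, HasDerivAt f (f' x) x)
  (hf' : ∀ x ∈ Icc (-1 : ℝ) 1, HasDerivAt f' (f'' x) x)
  (hf'' : ContinuousOn f'' (Icc (-1 : ℝ) 1))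
include hf hf' hf''

/-- `c_k(f) = −c_k(((1 − x²) f′)′)/(k(k + 1))` for `k ≥ 1` (row 422). -/
theorem coeff_sturm {k : ℕ} (hk : 1 ≤ k) :
    fourierLegendre f k = -fourierLegendre (sturm f' f'') k / ((k : ℝ) * ((k : ℝ) + 1)) :=
  fourierLegendre_eq_sturm hf hf' hf'' hk

/-- `Σ_k |c_k(f)| < ∞` for a `C²` function (row 422). -/
theorem coeff_summable : Summable (fun k => |fourierLegendre f k|) := summable_abs_fourierLegendre hf hf' hf''

/-- `S_d f → f` uniformly on `[−1, 1]` for a `C²` function (row 423). -/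
theorem uniform_convergence : TendstoUniformlyOn (fun d x => partialSum f d x) f atTop (Icc (-1 : ℝ) 1) :=
  tendstoUniformlyOn_partialSum hf hf' hf''

/-- `Σ_k c_k(f) P_k(x) = f(x)` on `[−1, 1]`, absolutely (row 423). -/
theorem hasSum_series {x : ℝ} (hx : x ∈ Icc (-1 : ℝ) 1) :
    HasSum (fun k => fourierLegendre f k * legP k x) (f x) :=
  hasSum_fourierLegendre_mul_legP hf hf' hf'' hx

end C2

section C4

variable {f f₁ f₂ f₃ f₄ : ℝ → ℝ}
  (h₁ : ∀ x ∈ Icc (-1 : ℝ) 1, HasDerivAt f (f₁ x) x)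
  (h₂ : ∀ x ∈ Icc (-1 : ℝ) 1, HasDerivAt f₁ (f₂ x) x)
  (h₃ : ∀ x ∈ Icc (-1 : ℝ) 1, HasDerivAt f₂ (f₃ x) x)
  (h₄ : ∀ x ∈ Icc (-1 : ℝ) 1, HasDerivAt f₃ (f₄ x) x)
  (h₄c : ContinuousOn f₄ (Icc (-1 : ℝ) 1))
include h₁ h₂ h₃ h₄ h₄c

/-- The rate `|f(x) − S_d f(x)| ≤ √(∫ (L²f)²)/d³` on `[−1, 1]` for a `C⁴` function (row 425). -/
theorem rate_C4 {d : ℕ} (hd : 1 ≤ d) {x : ℝ} (hx : x ∈ Icc (-1 : ℝ) 1) :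
    |f x - partialSum f d x| ≤ Real.sqrt (∫ x in (-1 : ℝ)..1, sturm2 f₁ f₂ f₃ f₄ x ^ 2) / (d : ℝ) ^ 3 :=
  abs_sub_partialSum_le_div_pow_three h₁ h₂ h₃ h₄ h₄c hd hx

/-- Termwise differentiation: `f′ = Σ_k c_k(f) P′_k` on `[−1, 1]` for a `C⁴` function (row 426). -/
theorem termwise_derivative : EqOn f₁ (fun x => ∑' k, fourierLegendre f k * legQ k x) (Icc (-1 : ℝ) 1) :=
  eqOn_deriv_tsum h₁ h₂ h₃ h₄ h₄c

/-- `(S_d f)′ → f′` uniformly on `[−1, 1]` for a `C⁴` function (row 426). -/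
theorem uniform_convergence_deriv :
    TendstoUniformlyOn (fun d x => partialSumDeriv f d x) f₁ atTop (Icc (-1 : ℝ) 1) :=
  tendstoUniformlyOn_partialSumDeriv h₁ h₂ h₃ h₄ h₄c

/-- `c_k(f′) = (2k + 1) Σ_{j≥0} c_{k+1+2j}(f)` for a `C⁴` function (row 427). -/
theorem deriv_coefficients (k : ℕ) :
    fourierLegendre f₁ k = (2 * (k : ℝ) + 1) * ∑' j, fourierLegendre f (k + 1 + 2 * j) :=
  fourierLegendre_deriv_eq_tsum h₁ h₂ h₃ h₄ h₄c k

/-- **The Gauss–Legendre error of a `C⁴` function is `O(n⁻³)`**: `|∫ f − Q_n f| ≤ 4 √(∫ (L²f)²)/(2n − 1)³`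
(`n ≥ 1`; row 424's stability bound with the polynomial `S_{2n−1} f` and row 425's rate). -/
theorem gauss_error_C4 {n : ℕ} (hn : 1 ≤ n) :
    |(∫ x in (-1 : ℝ)..1, f x) - gaussRule n f|
      ≤ 4 * (Real.sqrt (∫ x in (-1 : ℝ)..1, sturm2 f₁ f₂ f₃ f₄ x ^ 2) / ((2 * n - 1 : ℕ) : ℝ) ^ 3) := by
  have hfc : ContinuousOn f (Icc (-1 : ℝ) 1) := continuousOn_of_hasDerivAt h₁
  have hd : 1 ≤ 2 * n - 1 := by omega
  refine abs_integral_sub_gaussRule_le hn hfc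
    (p := ∑ k ∈ range (2 * n - 1 + 1), C (fourierLegendre f k) * legPoly k)
    (natDegree_partialSum_poly_le _ _) fun x hx => ?_
  rw [← partialSum_eq_eval]
  exact abs_sub_partialSum_le_div_pow_three h₁ h₂ h₃ h₄ h₄c hd hx

end C4

/-- `c_k(f) = c_{k−1}(f′)/(2k − 1) − c_{k+1}(f′)/(2k + 3)` for `k ≥ 1` and `f ∈ C¹` (row 427). -/
theorem coeff_of_deriv_coeff {f f₁ : ℝ → ℝ} (hf : ∀ x ∈ Icc (-1 : ℝ) 1, HasDerivAt f (f₁ x) x)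
    (hf₁ : ContinuousOn f₁ (Icc (-1 : ℝ) 1)) {k : ℕ} (hk : 1 ≤ k) :
    fourierLegendre f k
      = fourierLegendre f₁ (k - 1) / (2 * (k : ℝ) - 1) - fourierLegendre f₁ (k + 1) / (2 * (k : ℝ) + 3) :=
  fourierLegendre_eq_sub_deriv hf hf₁ hk

/-- `∫ P′_n P_k = 1 − (−1)^{n+k}` for `k < n`, `0` for `n ≤ k` (row 427). -/
theorem integral_deriv_mul (n k : ℕ) :
    ∫ x in (-1 : ℝ)..1, legQ n x * legP k x = if k < n then 1 - (-1 : ℝ) ^ (n + k) else 0 :=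
  integral_legQ_mul_legP n k

/-! ### Lebesgue's inequality and the Gauss–Legendre error for smooth functions (rows 424, 429) -/

/-- Lebesgue's inequality `|f − S_d f| ≤ (1 + (d + 1)²) E_d(f)` (row 429). -/
theorem lebesgue {f : ℝ → ℝ} (hf : ContinuousOn f (Icc (-1 : ℝ) 1)) {d : ℕ} {p : ℝ[X]} (hp : p.natDegree ≤ d)
    {M : ℝ} (hM : ∀ x ∈ Icc (-1 : ℝ) 1, |f x - p.eval x| ≤ M) {x : ℝ} (hx : x ∈ Icc (-1 : ℝ) 1) :
    |f x - partialSum f d x| ≤ (1 + ((d : ℝ) + 1) ^ 2) * M :=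
  abs_sub_partialSum_le_of_polynomial hf hp hM hx

/-- `|f − S_d f| ≤ (1 + (d + 1)²) sup |f^{(d+1)}|/(d + 1)!` for `f ∈ C^{d+1}(ℝ)` (row 429). -/
theorem series_error_smooth {f : ℝ → ℝ} {d : ℕ} (hf : ContDiff ℝ (d + 1) f) {C : ℝ}
    (hC : ∀ x ∈ Icc (-1 : ℝ) 1, |iteratedDeriv (d + 1) f x| ≤ C) {x : ℝ} (hx : x ∈ Icc (-1 : ℝ) 1) :
    |f x - partialSum f d x| ≤ (1 + ((d : ℝ) + 1) ^ 2) * (C / (d + 1).factorial) :=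
  abs_sub_partialSum_le_of_contDiff hf hC hx

/-- The Gauss–Legendre stability bound `|∫ f − Q_n f| ≤ 4 E_{2n−1}(f)` (row 424). -/
theorem gauss_error_stability {n : ℕ} (hn : 1 ≤ n) {f : ℝ → ℝ} (hf : ContinuousOn f (Icc (-1 : ℝ) 1)) {p : ℝ[X]}
    (hp : p.natDegree ≤ 2 * n - 1) {M : ℝ} (hM : ∀ x ∈ Icc (-1 : ℝ) 1, |f x - p.eval x| ≤ M) :
    |(∫ x in (-1 : ℝ)..1, f x) - gaussRule n f| ≤ 4 * M :=
  abs_integral_sub_gaussRule_le hn hf hp hM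

/-- `|∫ f − Q_n f| ≤ 4 sup |f^{(2n)}|/(2n)!` for `f ∈ C^{2n}(ℝ)` (row 424). -/
theorem gauss_error_smooth {n : ℕ} (hn : 1 ≤ n) {f : ℝ → ℝ} (hf : ContDiff ℝ ((2 * n : ℕ) : WithTop ℕ∞) f) {C : ℝ}
    (hC : ∀ x ∈ Icc (-1 : ℝ) 1, |iteratedDeriv (2 * n) f x| ≤ C) :
    |(∫ x in (-1 : ℝ)..1, f x) - gaussRule n f| ≤ 4 * (C / (2 * n).factorial) :=
  abs_integral_sub_gaussRule_le_of_contDiff hn hf hC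

/-! ### The discrete transform (row 428) -/

/-- Exact reconstruction of a polynomial of degree `≤ n − 1` from its `n` Gauss samples (row 428). -/
theorem discrete_transform_exact {n : ℕ} (hn : 1 ≤ n) {p : ℝ[X]} (hp : p.natDegree ≤ n - 1) (x : ℝ) :
    p.eval x = ∑ k ∈ range n, discreteCoeff n (fun x => p.eval x) k * legP k x :=
  eval_eq_sum_discreteCoeff hn hp x

/-- `c̃_k(f) → c_k(f)` for continuous `f` (row 428). -/
theorem discrete_transform_tendsto {f : ℝ → ℝ} (hf : ContinuousOn f (Icc (-1 : ℝ) 1)) (k : ℕ) :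
    Tendsto (fun n => discreteCoeff n f k) atTop (𝓝 (fourierLegendre f k)) :=
  tendsto_discreteCoeff hf k

end Summit.Ventures.HodgeRepro2.T5SU11LegendreSummaryV
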